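import Summits.BirchSwinnertonDyer.BirchSwinnertonDyer.Theorems.TwoAdicConverseOrdLambdaHalfAtTwoBDPTwoVariableDefs
import Literature.NumberTheory.IwasawaTheory.Greenberg2016.SelmerGroupStructure
import Mathlib.RingTheory.PowerSeries.Inverse
import Mathlib.RingTheory.PowerSeries.Order
import HarnessLib

/-!
# Line `residual_selmer_control_two` — crux `BDPSelmerLowerDivisibilityAtTwo` (O2), crux-ideate r1 seat 2 GEN 4

NODE (D-0171 shape; lens `control` = controlling quantity).  It REFINES the Λ-half leaf of the registered
lines `anticyclotomic_line_reading_two` (ACLR, seat 2 g3) / `anticyclotomic_fibre_pinning_two` (ACPIN, seat 1 g3):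
on a `ℤ₂`-line `L` of the frame the leaf is `(Λ)_L : red₁(G|_L) ∣ red₁(C₁|_L)` in `𝔽̄₂⟦T⟧`.  Since `𝔽̄₂⟦T⟧` is a
discrete valuation ring with uniformiser `T`, `(Λ)_L` is EQUIVALENT (given `(N)_L : red₁(G|_L) ≠ 0`) to the
inequality of `T`-adic orders `ord_T red₁(G|_L) ≤ ord_T red₁(C₁|_L)`, i.e. to `λ(G|_L) ≤ λ(C₁|_L)`
(`lambdaHalf_iff_order_le`, kernel-checked below).  The controlling quantity for the right-hand side is the
RESIDUAL SELMER GROUP of the `𝔽₂`-module `E[2]` over `K_∞^L`; the pieces that make the reading exact: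

* P1 `PurityAtTwo` — TORS₂ ⇒ `X_Gr₂` has no non-zero pseudo-null `Λ₂`-submodule: Greenberg 2016 Prop. 4.1.1
  case (c) with `η = v` (the RELAXED prime: `Q_𝓛(K_v,𝐃) = 0` coreflexive, `LOC_v⁽¹⁾` since `v` is finitely
  decomposed in `K̃_∞`); cases (a)/(b) are void on habitat (β) because `μ₂ ≅ 𝟙 ⊆ E[2]`.  Tree inputs by name:
  `Greenberg2016.prop411_selmer_isAlmostDivisible` (typed ∀ p), `Greenberg2006.weakLeopoldt_H2_subsingleton_above_cyclotomic`
  (LEO from Kato Thm. 12.4 at 2 for `f`, `f ⊗ χ_K`), `Greenberg2016/LOC2Archimedean` (complex places), CRK ⟸ TORS₂.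
  [WEAKER than O2; ATTACKABLE]
* P2 `LineTorsionFreeAtTwo` — no-PN ⇒ `X_Gr₂[f_L] = 0` off finitely many primes `f_L`
  (`Greenberg2016.HasNoPseudoNullSubmodule.exists_finite_forall_smul_eq_zero_imp`), whence
  `ch_{Λ_L}(X_Gr₂/f_L) = π_L(ch X_Gr₂)` (Herbrand quotient of a pseudo-null module along `f_L` is `1`).  [WEAKER; ATTACKABLE]
* P3 `LambdaReadingModTwo` — for a finitely generated `ℤ₂`-module with no non-zero finite submodule,
  `#(X/2X) = 2^{rank}`: the `λ`-invariant is read on `X/2X` (Matsuno 2008 §4, Lemma before Prop. 4.4; `K` imaginary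
  quadratic has NO real place, so Matsuno's archimedean condition `Σ₊` is void on every `ℤ₂`-line of `K`).  [WEAKER; ATTACKABLE]
* P4 (card only, UNDECIDED) — `dim_𝔽₂ S_𝓛(K_∞^L, E[2]) = λ(X_{rel,str}^{Σ₀}(E/K_∞^L)) + dim E(K_∞^L)[2]` with the residual
  local condition `𝓛_w = E(K_{∞,w})[2^∞]/2` at `w ∣ v̄`; dévissage along `0 → Φ → E[2] → Ψ → 0` (`Φ = E(ℚ)[2]`) into two
  GL(1) counts minus the rank of the cup-product (Hilbert-symbol) matrix `H_L : c ↦ c ∪ x_E`.  Test: layer-`n` 2-descents.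
* Leaves: GL(1) main conjecture on `L` at `2` (ATTACKABLE-GL1), `AN_L` = residual reading of `G|_L` (ac line: Kriz, in
  print; other lines: IDEA-NEEDED), the finite inequality `I_L` (INSTRUMENTABLE per `(E,K)`; IDEA-NEEDED in general),
  `(N)_L` untouched (leaf α of ACPIN).

Nothing here proves O2, O2♭ or any case of BSD; typed ≠ proved.  No `sorry`.
-/

set_option autoImplicit false

noncomputable section

open scoped Classical NumberField
open WeierstrassCurve NumberField IsDedekindDomain Field Function PowerSeries CongruenceSubgroup
open Literature.NumberTheory.EllipticCurves Literature.NumberTheory.EllipticCurves.Rank1Residual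
open Literature.NumberTheory.GaloisRepresentations
open Literature.NumberTheory.EllipticCurves.IwasawaAlgebra₂ Literature.NumberTheory.EllipticCurves.UnrSeries₂
open Literature.NumberTheory.EllipticCurves.BurungaleCastellaSkinner2025
open Literature.NumberTheory.EllipticCurves.YanZhu2026

namespace Summit.BirchSwinnertonDyer.BirchSwinnertonDyer.Cruxes.BDPSelmerLowerDivisibilityAtTwo.ResidualSelmerControlTwo

open Summit.BirchSwinnertonDyer.BirchSwinnertonDyer.Theorems.TwoAdicKatoDeterminant

/-! ## §1 The λ-currency of the Λ-half (kernel-checked) -/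

section LambdaCurrency

variable {k : Type*} [Field k]

/-- In `k⟦T⟧` (`k` a field) divisibility is the inequality of `T`-adic orders: `g ∣ c → ord g ≤ ord c`. -/
theorem order_le_of_dvd {g c : PowerSeries k} (h : g ∣ c) : g.order ≤ c.order := by
  obtain ⟨d, rfl⟩ := h
  rw [PowerSeries.order_mul]
  exact le_self_add

/-- In `k⟦T⟧` (`k` a field) a NON-ZERO `g` divides every `c` of `T`-adic order at least `ord g`
(`g = T^{ord g}·u`, `u` a unit). This is `λ(G|_L) ≤ λ(C₁|_L) ⟹ (Λ)_L` once `(N)_L : red₁(G|_L) ≠ 0`. -/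
theorem dvd_of_order_le {g c : PowerSeries k} (hg : g ≠ 0) (h : g.order ≤ c.order) : g ∣ c := by
  by_cases hc0 : c = 0
  · simp [hc0]
  have hcfin : c.order ≠ ⊤ := fun htop => hc0 (PowerSeries.order_eq_top.mp htop)
  have hle : g.order.toNat ≤ c.order.toNat := ENat.toNat_le_toNat h hcfin
  obtain ⟨u, hu⟩ := PowerSeries.isUnit_divided_by_X_pow_order hg
  have h1 : g ∣ (PowerSeries.X : PowerSeries k) ^ g.order.toNat := by
    refine ⟨↑u⁻¹, ?_⟩
    calc (PowerSeries.X : PowerSeries k) ^ g.order.toNat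
        = PowerSeries.X ^ g.order.toNat * (g.divXPowOrder * ↑u⁻¹) := by
          rw [← hu, Units.mul_inv, mul_one]
      _ = (PowerSeries.X ^ g.order.toNat * g.divXPowOrder) * ↑u⁻¹ := by ring
      _ = g * ↑u⁻¹ := by rw [PowerSeries.X_pow_order_mul_divXPowOrder]
  have h2 : (PowerSeries.X : PowerSeries k) ^ g.order.toNat ∣ c :=
    (pow_dvd_pow _ hle).trans PowerSeries.X_pow_order_dvd
  exact h1.trans h2

/-- **The re-typing of the leaf.** For `g ≠ 0`: `g ∣ c ↔ ord_T g ≤ ord_T c`. -/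
theorem dvd_iff_order_le {g c : PowerSeries k} (hg : g ≠ 0) : g ∣ c ↔ g.order ≤ c.order :=
  ⟨order_le_of_dvd, dvd_of_order_le hg⟩

end LambdaCurrency

/-- The residual line ring `𝔽̄₂⟦T⟧` of ACLR/ACPIN (`Ω₁` there): coefficientwise reductions of `𝒪_{ℂ₂}⟦T⟧`. -/
abbrev Ω₁ : Type := PowerSeries (IsLocalRing.ResidueField (PadicComplexInt 2))

/-- **NODE SEAM (kernel-checked).** On any line, with `g := red₁(G|_L)` and `c := red₁(C₁|_L)` (ACLR's `red₁ ∘ lineRes J a' b'`):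
`(N)_L ∧ (λ(G|_L) ≤ λ(C₁|_L)) → (N)_L ∧ (Λ)_L` — the exact shape of the conjunct ACLR/ACPIN/LINEDVD consume. -/
theorem lambdaHalf_of_order_le (g c : Ω₁) (hN : g ≠ 0) (hord : g.order ≤ c.order) : g ≠ 0 ∧ g ∣ c :=
  ⟨hN, dvd_of_order_le hN hord⟩

/-- Conversely the leaf as registered implies the λ-inequality: nothing is lost in the re-typing. -/
theorem lambdaHalf_iff_order_le (g c : Ω₁) (hN : g ≠ 0) : g ∣ c ↔ g.order ≤ c.order :=
  dvd_iff_order_le hN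

/-- The λ-inequality split through readings: an analytic reading `ord g = a`, an algebraic reading `ord c = b`
(P1–P4: `b = λ(X(E/K_∞^L)) = dim S_𝓛(K_∞^L,E[2]) − dim E(K_∞^L)[2]`) and the numerical inequality `a ≤ b`. -/
theorem lambdaHalf_of_readings (g c : Ω₁) (a b : ℕ∞) (hN : g ≠ 0) (han : g.order = a) (halg : c.order = b)
    (hab : a ≤ b) : g ≠ 0 ∧ g ∣ c :=
  lambdaHalf_of_order_le g c hN (han ▸ halg ▸ hab)

/-! ## §2 The pieces that make the algebraic reading exact (typed statements; nothing asserted) -/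

/-- **P1 PURITY₂ (WEAKER than O2; ATTACKABLE).** On O2's habitat: if the two-variable Greenberg dual Selmer module
`X_Gr₂(E/K̃_∞)` at `2` is `Λ₂`-torsion then it has no non-zero pseudo-null `Λ₂`-submodule — Greenberg 2016
Prop. 4.1.1 (c) with `η = v` the relaxed prime (`prop411_selmer_isAlmostDivisible`, typed for every `p`). -/
def PurityAtTwo : Prop :=
  ∀ (W : WeierstrassCurve ℚ) [W.IsElliptic] [W.IsGloballyMinimal],
    ¬ W.HasCM → GoodOrd W 2 → ¬ W.HasIrreducibleModPGaloisRep 2 →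
  ∀ (K : Type) [Field K] [NumberField K] [IsCMField K] (vbar : HeightOneSpectrum (𝓞 K))
    (κ₁ κ₂ : ZpExtension K 2) (γ₁ γ₂ : absoluteGaloisGroup K)
    [Fact (ZpExtension.IsTopGeneratorPair κ₁ κ₂ γ₁ γ₂)],
    IsImaginaryQuadratic K → ((2 : ℕ) : 𝓞 K) ∈ vbar.asIdeal →
    Module.IsTorsion (IwasawaAlgebra₂ 2) ((W.baseChange K).XGr₂ 2 κ₁ κ₂ vbar γ₁ γ₂) →
    Literature.NumberTheory.IwasawaTheory.Greenberg2016.HasNoPseudoNullSubmodule (IwasawaAlgebra₂ 2)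
      ((W.baseChange K).XGr₂ 2 κ₁ κ₂ vbar γ₁ γ₂)

/-- **P2 LINE TORSION-FREENESS (WEAKER; ATTACKABLE — the tree's
`HasNoPseudoNullSubmodule.exists_finite_forall_smul_eq_zero_imp` in `X_Gr₂`'s clothes).** Off finitely many prime
classes `f` of `Λ₂`, `X_Gr₂[f] = 0`; so the specialisation to a good line is exact on characteristic ideals. -/
def LineTorsionFreeAtTwo : Prop :=
  ∀ (W : WeierstrassCurve ℚ) [W.IsElliptic] [W.IsGloballyMinimal]
    (K : Type) [Field K] [NumberField K] [IsCMField K] (vbar : HeightOneSpectrum (𝓞 K))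
    (κ₁ κ₂ : ZpExtension K 2) (γ₁ γ₂ : absoluteGaloisGroup K)
    [Fact (ZpExtension.IsTopGeneratorPair κ₁ κ₂ γ₁ γ₂)],
    Literature.NumberTheory.IwasawaTheory.Greenberg2016.HasNoPseudoNullSubmodule (IwasawaAlgebra₂ 2)
      ((W.baseChange K).XGr₂ 2 κ₁ κ₂ vbar γ₁ γ₂) →
    ∃ B : Set (IwasawaAlgebra₂ 2), B.Finite ∧
      ∀ f : IwasawaAlgebra₂ 2, Prime f → (∀ b ∈ B, ¬ Associated f b) →
        ∀ x : (W.baseChange K).XGr₂ 2 κ₁ κ₂ vbar γ₁ γ₂, f • x = 0 → x = 0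

open scoped Pointwise in
/-- **P3 λ READ MOD 2 (WEAKER; ATTACKABLE — finitely generated modules over the PID `ℤ₂`).** A finitely generated
`ℤ₂`-module with no non-zero finite submodule (= torsion-free = free) has `#(X/2X) = 2^{rank X}`; with a finite
submodule `F` the count reads `2^{rank X}·#(F/2F)`, which is why P1's one-variable companion (`F_L = 0` on a torsion
line, same Prop. 4.1.1 (c) with `m = 1`) is load-bearing for a LOWER bound on `λ`. -/
def LambdaReadingModTwo : Prop :=
  ∀ (X : Type) [AddCommGroup X] [Module ℤ_[2] X] [Module.Finite ℤ_[2] X] [NoZeroSMulDivisors ℤ_[2] X],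
    Nat.card (X ⧸ (2 : ℤ_[2]) • (⊤ : Submodule ℤ_[2] X)) = 2 ^ Module.finrank ℤ_[2] X

end Summit.BirchSwinnertonDyer.BirchSwinnertonDyer.Cruxes.BDPSelmerLowerDivisibilityAtTwo.ResidualSelmerControlTwo

end
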